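import Literature.MathematicalPhysics.QuantumFieldTheory.Balaban1983to89.B9Eq353FormDefectTowerPiTwoBackgrounds
import Literature.MathematicalPhysics.QuantumFieldTheory.Balaban1983to89.B9Thm311LaplaceAkPiPositiveDiagonal

/-!
# `Balaban1983to89.B9Eq386GreenkLipschitzEnergyPiTwoBackgrounds` — T. Bałaban, *Propagators for lattice gauge theories in a background field*, Commun. Math.
# Phys. **99** (1985) 389–434 [Balaban1985BackgroundPropagators] Thm 3.4 p. 400, (3.84)–(3.86) p. 407, (3.122) p. 420, (3.130) p. 421, Thm 3.11 p. 416: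
# **PRINT's `k`-TH-STEP GREEN's FUNCTION `G̃_k = (Δ̃_{a,k})⁻¹` ((3.122)) IS LIPSCHITZ BETWEEN TWO SMALL BACKGROUNDS IN THE FLAT ENERGY NORM ON THE DIAGONAL,
# LETTER-FREE — `‖G̃_k(U)y − G̃_k(V)y‖, ‖curl₁(…)‖, ‖div₁(…)‖ ≤ C·δ·‖y‖` WITH ONE `∃ α₀ δ₀ C` BEFORE EVERY BINDER** — the π twin ((T4)-2) of this lineage's
# gen-77 `B9Eq386GreenkLipschitzEnergyTwoBackgroundsLetterfree` (the same row for the chain's `G_k = (Δ_{a,k})⁻¹` at the `G₀`-slot)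

statement-level skeleton of published theorems with citation tags; proofs where landed; nothing here is a claim about the Yang–Mills mass gap

PDF held: `paper:balaban1985-cmp99-background-propagators` (journal page = PDF page + 388), pp. 400, 407, 416, 420–421 — through the suppliers' quotations.

CITATION HEADER (lean-in-tree rule 2026-08-18).  Audit cell `pub-balaban`, sub-cell `t4`, NE9 crux team (2): LEAF PROVER 04 (`b2b-balaban-t4-ne9-formalise-leaf-04`
gen 79), INTENT-4 = (T4)-2 (the row OWNER t4-ne9-p1's GO `CLAIMS.log` l.53352 W-9 (α) «(T3)∕(T4) the π twins … for the successor»).  WHY (cell context;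
DIAGNOSIS D-ne9p1-g87-1, the `Δ_π` port): NE9 compares the `k`-th-step letters of two coupling histories, i.e. at two small backgrounds `U`, `V`; at print's operator
(3.122) the first such row is the Green's function `G̃_k(X) = greenK (laplaceAkPi … X …)`, Lipschitz in `X` to first order in the closeness `δ`.

THE PRINT (verbatim via the suppliers).  p. 400 Thm 3.4: *«G(U) is an analytic function of U′ on the space of configurations U′ satisfying (3.35)»* — read in the cell
as Lipschitz continuity between two points of the small-field ball, first order; p. 420: *«the operator G used in the above formula has all the properties formulated in
Theorems 3.3, 3.10, 3.11»*; p. 407 (3.84)–(3.86) (the resolvent comparison; paraphrase).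

WHAT IS PROVED (sorry-free; proof lane — no `def`, no `Prop` placeholder; [folklore] the gen-77 INTENT-8∕-9 text with two suppliers swapped).
* **`exists_norm_G1kPi_sub_G1kPi_le_two_backgrounds_letterfree`** — `∃ α₀ δ₀ C > 0` (closed in `(d, a, a′, L, M_φ, M_φ′, r, C_τ, ρ_w)`) such that under the binder
  list of `B9Eq353FormDefectTowerPiTwoBackgrounds.exists_form_defect_pi_two_backgrounds_letterfree` (E162's per-level data at `U` and `V`, the base at `V` `≤ 1∕128`;
  level smallness `ε_j ≤ αr^j` (`j < n+1`) and closeness `δ_j ≤ δr^j`; `hRS` ×2, `U1` ×2, bond ∕ plaquette windows ×2, closeness `δη` ∕ `δη²`; `0 ≤ α ≤ α₀`,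
  `0 ≤ δ ≤ δ₀`; ANY `hpos′_U`, `hpos′_V` defining `G′_k`) and ANY positivity witnesses `hposU`, `hposV` of `Δ̃_{a,k}(U)`, `Δ̃_{a,k}(V)`, for every `y`:
  `‖G̃_k(U)y − G̃_k(V)y‖, ‖curl₁(G̃_k(U)y − G̃_k(V)y)‖, ‖div₁(G̃_k(U)y − G̃_k(V)y)‖ ≤ C·δ·‖y‖`, `G̃_k(X)y = B11Eq103H1Complex.greenK (laplaceAkPi … X …) hposX y`.
  MECHANISM (verbatim the `G₀`-slot text): the energy-weight perturbation `B9Eq386GreenLipschitzEnergy.weight_green_sub_le_of_bound` on the two-background form defect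
  `Θ·δ·N₁(u)N₁(v)` of `Δ̃_{a,k}` ((T4)-1 `exists_form_defect_pi_two_backgrounds_letterfree`), the strong coercivity `γ` of `Δ̃_{a,k}(U)` in the flat weight and the
  row `N₁(G̃_k(V)y) ≤ γ⁻¹‖y‖` from the coercivity at `V` (the OWNER's `B9Thm311LaplaceAkPiPositiveDiagonal.exists_laplaceAkPi_coercive_diagonal_closed` at `U` AND at
  `V`; the averaged `U1` letters it wants come from E162's data by `hLb_of_hU1`); `C = (Θ∕γ)γ⁻¹`.
MODEL ∕ DECLARED READINGS.  Those of (T4)-1 (every window ∕ profile ∕ closeness letter, E162's data, `hRS`, `ρ_w` HYPOTHESES; the four witnesses binders).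
HONEST SCOPE.  [folklore] composition BY NAME; FIRST order between two small backgrounds on the diagonal ONLY (no analyticity, no Neumann series); Thm 3.4's `L²` ∕
ENERGY clause only — NO kernel bound (3.42)–(3.47), NO decay (Thm 3.10); crude constants.  NOT summit progress (cell pub-balaban: NE9 NOT PRINTED ∕ NOT PROVED;
«NE9 ⇐ the named binders»; row WALLED ON A MODEL (O-NE9-1; NEEDS-COORDINATOR #5 UNRULED); spine PROVED 0∕9; rung (B)+1 finite T⁴ — NOT infinite volume, NOT mass
gap, NOT BetaPertH, NOT Clay).  HONEST DEPENDENCY (cell line): continuum YM on T⁴ ⇐ BetaPertH ∧ nine spine estimates (0/9 proved); BetaPertH ⇐ (D1) ∧ (D4) ∧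
CAP+tail; G-an2-4 gates asym, D1 and NE2/3/4.  NEW file; nothing modified.  Net new unproved facts: 0.
-/

noncomputable section

open scoped InnerProductSpace ComplexConjugate BigOperators

namespace Literature.MathematicalPhysics.QuantumFieldTheory.Balaban1983to89.B9Eq386GreenkLipschitzEnergyPiTwoBackgrounds

open B4Sect5Torus (TSite)
open B9SectCLatticeCarrier (Bond)
open B11Eq103H1Complex (SiteL2K BondL2K covDivL2K greenK)
open B9Eq310HessianOperator (adTransportW covCurlL2K)
open B9Eq310DeltaPrime (plaqHolU)
open B9Eq315QTorus (perCfg cornerSite)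
open B9Eq315QTower (towerP UlevOf)
open B9Eq324DeltaPrimeATower (laplacePrimeAk)
open B9Eq3119DeltaPiTower (laplaceAkPi)
open B7Prop1Explicit (U1 Wcx boxVec)
open B9Thm311SmallFieldCoercivityTowerClosed (hLb_of_hU1)
open B9Eq386GreenLipschitzEnergy (weight_green_le weight_green_sub_le_of_bound)
open B9Thm311LaplaceAkPiPositiveDiagonal (exists_laplaceAkPi_coercive_diagonal_closed)
open B9Eq353FormDefectTowerPiTwoBackgrounds (exists_form_defect_pi_two_backgrounds_letterfree)

/-- `x ≤ √S` from `0 ≤ x` and `x² ≤ S`. [folklore] -/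
private theorem le_sqrt_of_sq_le {x S : ℝ} (hx : 0 ≤ x) (h : x ^ 2 ≤ S) : x ≤ Real.sqrt S := by
  rw [← Real.sqrt_sq hx]; exact Real.sqrt_le_sqrt h

variable {d : ℕ} (L : ℕ) [NeZero L] (hL : 1 ≤ L)
  {𝔸 : Type*} [NormedRing 𝔸] [NormedAlgebra ℂ 𝔸] [CompleteSpace 𝔸] [NormOneClass 𝔸] [StarRing 𝔸] [NormedStarGroup 𝔸] [StarModule ℂ 𝔸]
  {W : Type*} [NormedAddCommGroup W] [InnerProductSpace ℂ W] [FiniteDimensional ℂ W] (φ : W ≃ₗ[ℂ] 𝔸)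
  {Mφ Mφ' : ℝ} (hMφ : 0 ≤ Mφ) (hMφ' : 0 ≤ Mφ') (hφ : ∀ w, ‖φ w‖ ≤ Mφ * ‖w‖) (hφ' : ∀ X, ‖φ.symm X‖ ≤ Mφ' * ‖X‖)
  {a : ℝ} (ha : 0 < a) {a' : ℝ} (ha' : 0 < a') {r : ℝ} (hr0 : 0 ≤ r) (hr1 : r < 1)
  (τ : 𝔸 →ₗ[ℂ] ℂ) {Cτ : ℝ} (hτ : ∀ X, ‖τ X‖ ≤ Cτ * ‖X‖) (hCτ : 0 ≤ Cτ) {ρw : ℝ} (hρw : 0 ≤ ρw)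

include hMφ hMφ' hφ hφ' ha ha' hr0 hr1 hτ hCτ hρw

/-- **PRINT's `G̃_k` IS LIPSCHITZ BETWEEN TWO SMALL BACKGROUNDS IN THE ENERGY NORM ON THE DIAGONAL, LETTER-FREE** — see the module header: `∃ α₀ δ₀ C > 0` before
every binder; then for ANY `hpos′_U`, `hpos′_V` (defining `G′_k`), ANY positivity witnesses `hposU`, `hposV` of `Δ̃_{a,k}(U)`, `Δ̃_{a,k}(V)` and every `y`:
`‖G̃_k(U)y − G̃_k(V)y‖, ‖curl₁(…)‖, ‖div₁(…)‖ ≤ C·δ·‖y‖`. [folklore]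
[cite: Balaban1985BackgroundPropagators, Thm 3.4 p.400, (3.84)–(3.86) p.407, (3.122) p.420, (3.130) p.421, Thm 3.11 p.416, (3.35) p.396] -/
theorem exists_norm_G1kPi_sub_G1kPi_le_two_backgrounds_letterfree :
    ∃ α₀ δ₀ C : ℝ, 0 < α₀ ∧ 0 < δ₀ ∧ 0 < C ∧ ∀ (n : ℕ) (η : ℝ), η * (L : ℝ) ^ (n + 1) = 1 →
      ∀ (c₀ c₁ : ℝ) [Fact (0 < c₀)] [Fact (0 < c₁)], c₀ * ((L : ℝ) ^ (n + 1)) ^ d = c₁ → |η| ^ d / c₀ ≤ ρw →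
      ∀ (m : Fin d → ℕ) [∀ i, NeZero (m i)] (U V : Bond d (towerP L m (n + 1)) → 𝔸ˣ) (αU : ℕ → ℝ) (hα1 : ∀ j, αU j ≤ 1 / 64)
        (hU1 : ∀ (j : ℕ) (x : B7Prop1Explicit.Site d) (κ : Fin d), perCfg (towerP L m (j + 1)) (UlevOf L m (n + 1) U j) x κ ∈ U1 𝔸)
        (hreg : ∀ (j : ℕ) (y : TSite d (towerP L m j)) (κ : Fin d) (r : Fin d → Fin L),
          ‖((Wcx L (perCfg (towerP L m (j + 1)) (UlevOf L m (n + 1) U j)) (cornerSite L y) κ (boxVec L r) : 𝔸ˣ) : 𝔸) - 1‖ ≤ αU j)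
        (αV : ℕ → ℝ) (hα1' : ∀ j, αV j ≤ 1 / 64)
        (hV1 : ∀ (j : ℕ) (x : B7Prop1Explicit.Site d) (κ : Fin d), perCfg (towerP L m (j + 1)) (UlevOf L m (n + 1) V j) x κ ∈ U1 𝔸)
        (hregV : ∀ (j : ℕ) (y : TSite d (towerP L m j)) (κ : Fin d) (r : Fin d → Fin L),
          ‖((Wcx L (perCfg (towerP L m (j + 1)) (UlevOf L m (n + 1) V j)) (cornerSite L y) κ (boxVec L r) : 𝔸ˣ) : 𝔸) - 1‖ ≤ αV j),
        (∀ j, αV j ≤ 1 / 128) →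
      ∀ (εU : ℕ → ℝ), (∀ j, 0 ≤ εU j) → (∀ (j : ℕ) (b : Bond d (towerP L m (j + 1))), ‖(UlevOf L m (n + 1) U j b : 𝔸) - 1‖ ≤ εU j) →
        (∀ (j : ℕ) (b : Bond d (towerP L m (j + 1))), ‖(UlevOf L m (n + 1) V j b : 𝔸) - 1‖ ≤ εU j) →
      ∀ (δUV : ℕ → ℝ), (∀ j, 0 ≤ δUV j) →
        (∀ (j : ℕ) (b : Bond d (towerP L m (j + 1))), ‖(UlevOf L m (n + 1) U j b : 𝔸) - (UlevOf L m (n + 1) V j b : 𝔸)‖ ≤ δUV j) →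
      ∀ {α δ : ℝ}, 0 ≤ α → α ≤ α₀ → 0 ≤ δ → δ ≤ δ₀ →
        (∀ (b : Bond d (towerP L m (n + 1))) (v u : W), ⟪adTransportW φ U b v, u⟫_ℂ = ⟪v, adTransportW φ (fun b => (U b)⁻¹) b u⟫_ℂ) →
        (∀ (b : Bond d (towerP L m (n + 1))) (v u : W), ⟪adTransportW φ V b v, u⟫_ℂ = ⟪v, adTransportW φ (fun b => (V b)⁻¹) b u⟫_ℂ) →
        (∀ b, U b ∈ U1 𝔸) → (∀ b, V b ∈ U1 𝔸) → (∀ b, ‖(U b : 𝔸) - 1‖ ≤ α * η) → (∀ b, ‖(V b : 𝔸) - 1‖ ≤ α * η) →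
        (∀ p : B9SectCLatticeCarrier.Plaq d (towerP L m (n + 1)), ‖(plaqHolU U p : 𝔸) - 1‖ ≤ α * η ^ 2) →
        (∀ p : B9SectCLatticeCarrier.Plaq d (towerP L m (n + 1)), ‖(plaqHolU V p : 𝔸) - 1‖ ≤ α * η ^ 2) →
        (∀ b, ‖(U b : 𝔸) - (V b : 𝔸)‖ ≤ δ * η) →
        (∀ p : B9SectCLatticeCarrier.Plaq d (towerP L m (n + 1)), ‖(plaqHolU U p : 𝔸) - (plaqHolU V p : 𝔸)‖ ≤ δ * η ^ 2) →
        (∀ j < n + 1, εU j ≤ α * r ^ j) → (∀ j, δUV j ≤ δ * r ^ j) →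
        ∀ (hposU' : ∀ x : SiteL2K ℂ d (towerP L m (n + 1)) c₀ W, x ≠ 0 → 0 < RCLike.re ⟪x, laplacePrimeAk L m n φ η U a' (c₁ := c₁) x⟫_ℂ)
          (hposV' : ∀ x : SiteL2K ℂ d (towerP L m (n + 1)) c₀ W, x ≠ 0 → 0 < RCLike.re ⟪x, laplacePrimeAk L m n φ η V a' (c₁ := c₁) x⟫_ℂ)
          (hposU : ∀ x : BondL2K ℂ d (towerP L m (n + 1)) c₀ W, x ≠ 0 →
            0 < RCLike.re ⟪x, laplaceAkPi L m n φ τ η U a' hposU' hL αU hα1 hU1 hreg (c₁ := c₁) a x⟫_ℂ)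
          (hposV : ∀ x : BondL2K ℂ d (towerP L m (n + 1)) c₀ W, x ≠ 0 →
            0 < RCLike.re ⟪x, laplaceAkPi L m n φ τ η V a' hposV' hL αV hα1' hV1 hregV (c₁ := c₁) a x⟫_ℂ)
          (y : BondL2K ℂ d (towerP L m (n + 1)) c₀ W),
          ‖greenK (laplaceAkPi L m n φ τ η U a' hposU' hL αU hα1 hU1 hreg (c₁ := c₁) a) hposU y -
            greenK (laplaceAkPi L m n φ τ η V a' hposV' hL αV hα1' hV1 hregV (c₁ := c₁) a) hposV y‖ ≤ C * δ * ‖y‖ ∧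
          ‖covCurlL2K ℂ c₀ ((η : ℂ))⁻¹ (adTransportW φ (fun _ : Bond d (towerP L m (n + 1)) => (1 : 𝔸ˣ)))
            (greenK (laplaceAkPi L m n φ τ η U a' hposU' hL αU hα1 hU1 hreg (c₁ := c₁) a) hposU y -
            greenK (laplaceAkPi L m n φ τ η V a' hposV' hL αV hα1' hV1 hregV (c₁ := c₁) a) hposV y)‖ ≤ C * δ * ‖y‖ ∧
          ‖covDivL2K ℂ c₀ ((η : ℂ))⁻¹ (adTransportW φ fun _ : Bond d (towerP L m (n + 1)) => (1 : 𝔸ˣ)⁻¹)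
            (greenK (laplaceAkPi L m n φ τ η U a' hposU' hL αU hα1 hU1 hreg (c₁ := c₁) a) hposU y -
            greenK (laplaceAkPi L m n φ τ η V a' hposV' hL αV hα1' hV1 hregV (c₁ := c₁) a) hposV y)‖ ≤ C * δ * ‖y‖ := by
  obtain ⟨α₁, γ₁, hα₁, hγ₁, H1⟩ := exists_laplaceAkPi_coercive_diagonal_closed (d := d) L hL φ hMφ hMφ' hφ hφ' ha ha' hr0 hr1 τ hτ hCτ hρw
  obtain ⟨α₂, δ₀, Θ, hα₂, hδ₀, hΘ, H2⟩ :=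
    exists_form_defect_pi_two_backgrounds_letterfree (d := d) L hL φ hMφ hMφ' hφ hφ' ha ha' hr0 hr1 τ hτ hCτ hρw
  refine ⟨min α₁ α₂, δ₀, Θ / γ₁ * γ₁⁻¹, lt_min hα₁ hα₂, hδ₀, by positivity, ?_⟩
  intro n η hηL c₀ c₁ _ _ hw hρ m _ U V αU hα1 hU1 hreg αV hα1' hV1 hregV hα128 εU hεU hUε hVε δUV hδUV hLUV α δ hα0 hαle hδ0 hδle
    hRSU hRSV hUb hVb hUη hVη hplU hplV hUV hpp hεg hδg hposU' hposV' hposU hposV y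
  have hαα₁ : α ≤ α₁ := hαle.trans (min_le_left _ _)
  have hαα₂ : α ≤ α₂ := hαle.trans (min_le_right _ _)
  have hLbU := hLb_of_hU1 L m n U hU1
  have hLbV := hLb_of_hU1 L m n V hV1
  have HU := H1 n η hηL c₀ c₁ hw hρ m U αU hα1 hU1 hreg εU hεU hUε hα0 hαα₁ hRSU hUb hUη hplU hεg hLbU hposU'
  have HV := H1 n η hηL c₀ c₁ hw hρ m V αV hα1' hV1 hregV εU hεU hVε hα0 hαα₁ hRSV hVb hVη hplV hεg hLbV hposV'
  have HT := H2 n η hηL c₀ c₁ hw hρ m U V αU hα1 hU1 hreg αV hα1' hV1 hregV hα128 εU hεU hUε hVε δUV hδUV hLUV hα0 hαα₂ hδ0 hδle hRSU hRSV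
    hUb hVb hUη hVη hplU hplV hUV hpp hεg hδg hposU' hposV'
  have hΘδ : 0 ≤ Θ * δ := mul_nonneg hΘ.le hδ0
  obtain ⟨N, hNdef⟩ : ∃ N : BondL2K ℂ d (towerP L m (n + 1)) c₀ W → ℝ, N = fun z =>
      Real.sqrt (‖covCurlL2K ℂ c₀ ((η : ℂ))⁻¹ (adTransportW φ (fun _ : Bond d (towerP L m (n + 1)) => (1 : 𝔸ˣ))) z‖ ^ 2 +
        ‖covDivL2K ℂ c₀ ((η : ℂ))⁻¹ (adTransportW φ fun _ : Bond d (towerP L m (n + 1)) => (1 : 𝔸ˣ)⁻¹) z‖ ^ 2 + ‖z‖ ^ 2) := ⟨_, rfl⟩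
  have hNz : ∀ z, N z = Real.sqrt (‖covCurlL2K ℂ c₀ ((η : ℂ))⁻¹ (adTransportW φ (fun _ : Bond d (towerP L m (n + 1)) => (1 : 𝔸ˣ))) z‖ ^ 2 +
      ‖covDivL2K ℂ c₀ ((η : ℂ))⁻¹ (adTransportW φ fun _ : Bond d (towerP L m (n + 1)) => (1 : 𝔸ˣ)⁻¹) z‖ ^ 2 + ‖z‖ ^ 2) := fun z => by rw [hNdef]
  have hN0 : ∀ z, 0 ≤ N z := fun z => by rw [hNz]; exact Real.sqrt_nonneg _
  have hNsq : ∀ z, N z ^ 2 = ‖covCurlL2K ℂ c₀ ((η : ℂ))⁻¹ (adTransportW φ (fun _ : Bond d (towerP L m (n + 1)) => (1 : 𝔸ˣ))) z‖ ^ 2 +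
      ‖covDivL2K ℂ c₀ ((η : ℂ))⁻¹ (adTransportW φ fun _ : Bond d (towerP L m (n + 1)) => (1 : 𝔸ˣ)⁻¹) z‖ ^ 2 + ‖z‖ ^ 2 := fun z => by
    rw [hNz]; exact Real.sq_sqrt (add_nonneg (add_nonneg (sq_nonneg _) (sq_nonneg _)) (sq_nonneg _))
  have hNn : ∀ z, ‖z‖ ≤ N z := fun z => by
    rw [hNz]; exact le_sqrt_of_sq_le (norm_nonneg _) (le_add_of_nonneg_left (add_nonneg (sq_nonneg _) (sq_nonneg _)))
  have hNc : ∀ z, ‖covCurlL2K ℂ c₀ ((η : ℂ))⁻¹ (adTransportW φ (fun _ : Bond d (towerP L m (n + 1)) => (1 : 𝔸ˣ))) z‖ ≤ N z := fun z => by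
    rw [hNz]; exact le_sqrt_of_sq_le (norm_nonneg _) ((le_add_of_nonneg_right (sq_nonneg _)).trans (le_add_of_nonneg_right (sq_nonneg _)))
  have hNd : ∀ z, ‖covDivL2K ℂ c₀ ((η : ℂ))⁻¹ (adTransportW φ fun _ : Bond d (towerP L m (n + 1)) => (1 : 𝔸ˣ)⁻¹) z‖ ≤ N z := fun z => by
    rw [hNz]; exact le_sqrt_of_sq_le (norm_nonneg _) ((le_add_of_nonneg_left (sq_nonneg _)).trans (le_add_of_nonneg_right (sq_nonneg _)))
  have hcoerU : ∀ z, γ₁ * N z ^ 2 ≤ RCLike.re ⟪z, laplaceAkPi L m n φ τ η U a' hposU' hL αU hα1 hU1 hreg (c₁ := c₁) a z⟫_ℂ := fun z => by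
    rw [hNsq]; exact HU z
  have hcoerV : ∀ z, γ₁ * N z ^ 2 ≤ RCLike.re ⟪z, laplaceAkPi L m n φ τ η V a' hposV' hL αV hα1' hV1 hregV (c₁ := c₁) a z⟫_ℂ := fun z => by
    rw [hNsq]; exact HV z
  have hT : ∀ u v : BondL2K ℂ d (towerP L m (n + 1)) c₀ W, ‖⟪u, laplaceAkPi L m n φ τ η U a' hposU' hL αU hα1 hU1 hreg (c₁ := c₁) a v⟫_ℂ -
      ⟪u, laplaceAkPi L m n φ τ η V a' hposV' hL αV hα1' hV1 hregV (c₁ := c₁) a v⟫_ℂ‖ ≤ Θ * δ * N u * N v :=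
    fun u v => by rw [hNz u, hNz v]; exact HT u v
  have hGV : ∀ y, N (greenK _ hposV y) ≤ γ₁⁻¹ * ‖y‖ := fun y => weight_green_le (𝕜 := ℂ) hposV N hN0 hNn hγ₁ hcoerV y
  have hz : N (greenK _ hposV y - greenK _ hposU y) ≤ Θ * δ / γ₁ * γ₁⁻¹ * ‖y‖ :=
    weight_green_sub_le_of_bound (𝕜 := ℂ) hposV hposU N hN0 hγ₁ hΘδ hcoerU hT hGV y
  have hzB : N (greenK _ hposV y - greenK _ hposU y) ≤ Θ / γ₁ * γ₁⁻¹ * δ * ‖y‖ := by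
    rw [show Θ / γ₁ * γ₁⁻¹ * δ * ‖y‖ = Θ * δ / γ₁ * γ₁⁻¹ * ‖y‖ by ring]; exact hz
  have hneg : greenK _ hposU y - greenK _ hposV y = -(greenK _ hposV y - greenK _ hposU y) := (neg_sub _ _).symm
  refine ⟨?_, ?_, ?_⟩
  · rw [hneg, norm_neg]; exact (hNn _).trans hzB
  · rw [hneg, map_neg, norm_neg]; exact (hNc _).trans hzB
  · rw [hneg, map_neg, norm_neg]; exact (hNd _).trans hzB

end Literature.MathematicalPhysics.QuantumFieldTheory.Balaban1983to89.B9Eq386GreenkLipschitzEnergyPiTwoBackgrounds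

end
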